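import Literature.Computability.MetaComplexity.UPSearchNP
import Literature.Computability.Complexity.ReductionsProofs
import HarnessLib

/-!
# Complexity meta: Lemma 5.1 of Hirahara 2021 (`Gap(K vs K) ∈ pr-P`) from algorithmic language compression (Thm. 4.2)

Topic `Literature/Computability/MetaComplexity`, proof companion of `LanguageCompression.lean` for
S. Hirahara, *Average-case hardness of NP from exponential worst-case hardness assumptions*, STOC 2021,
full version ECCC TR21-058. That file vendors **Lemma 5.1** (`Hirahara2021_gapKvsK_mem_PromiseP`:
`coNP × {U, T} ⊆ Avg¹_{1-n^{-c}} P ⟹ Gap_τ(K vs K) ∈ pr-P` for some polynomial `τ`) and **Thm. 4.2**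
(`Hirahara2021_languageCompression`, algorithmic language compression) as two named facts. In print
Lemma 5.1 is *proved from* Thm. 4.2 in half a page (p. 29: "For completeness, we present a simple proof
based on the algorithmic language compression theorem"; "Theorem 4.2 is a generalization of Lemma 5.1",
p. 16). This file formalises exactly that proof (theorems only, no new definitions or facts), making Lemma 5.1 a
theorem relative to Thm. 4.2:

* `Hirahara2021_gapKvsK_mem_PromiseP_of_languageCompression :
    Hirahara2021_languageCompression → Hirahara2021_gapKvsK_mem_PromiseP`.

so that the discharge `Hirahara2021_gapKvsK_mem_PromiseP_holds` is this theorem fed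
`Hirahara2021_languageCompression_holds` once the latter exists (D-0026 review of 2026-08-15: the fact
is not to be split further; its only depth is Thm. 4.2).

## The printed proof (TR21-058, p. 29) and its rendering

*Consider the ensemble `L = {L_{⟨t,s⟩}}` with `L_{⟨t,s⟩} := {x | K^t(x) ≤ s}`. Observe that
`|L_{⟨t,s⟩}| ≤ 2^{s+1}` by Fact 3.7 and `L ∈ NP`. Applying Theorem 4.2 to `L`, we obtain a
polynomial-time algorithm that solves `Π_Yes := L`, `Π_No := {(x, 1^{⟨t,s⟩}) | K^{p(t+s)}(x) > s + 1 +
log p(t+s)}` for some polynomial `p`. `Gap_τ(K vs K)` is reducible to this promise problem via the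
identity map for some polynomial `τ`.*

* The ensemble is taken to be `U.upLang Set.univ 0` — the language `L'` of the proof of Thm. 8.9
  (`UPSearchNP.lean`) for the trivial verifier —, whose slice at the index `⟨n, 0, t, s⟩ = idx4 n 0 t s`
  is `{x ∈ {0,1}ⁿ | K^t(x) ≤ s}` (`languageSlice_upLang_univ_zero`): the printed `L_{⟨t,s⟩}`
  additionally sliced by the length `n = |x|` (as the paper itself does in §8), which only shrinks the
  slices. `L ∈ NP` and Def. 4.1 are then the proved `upLang_mem_NP` (with `univ_mem_P`) and
  `isLanguageEnsemble_upLang`.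
* Fact 3.7 is `UniversalMachine.ncard_setOf_ktAt_lt` (`|{x | K^t(x) < s+1}| < 2^{s+1}`), whence
  `log |L_{⟨n,0,t,s⟩}| ≤ s` (`log_ncard_slice_le`, `log = Nat.log 2`).
* "The identity map" between the two encodings `⟨x, 1ᵗ, 1ˢ⟩ = boolPair x (boolPair 1ᵗ 1ˢ)` (`U.MINKT`)
  and `(x, 1^{⟨n,0,t,s⟩}) = paramEnc (x, idx4 n 0 t s)` is an `FP` re-encoding (bricks `idx4UF`,
  `onesFn`, `fanoutFn`; `exists_gapRed`), and `pr-P` is closed under `FP` preimages (`preimage_mem_P`).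
* "For some polynomial `τ`": on a no-instance `K^{τ(|x|+t)}(x) > s + log τ(|x|+t)` forces
  `s < |x| + a₀` by the trivial bound `K^{t}(x) ≤ |x| + a₀` (`t ≥ c₀`, `exists_ktAt_le_length_add`), so
  the index `⟨|x|,0,t,s⟩` is polynomially bounded in `|x| + t` (`exists_poly_idx4_le`, from
  `Nat.pair a b ≤ (a+b+1)²`), and `τ := p ∘ Q + X + (c₀ + 1)` with `Q` that bound works:
  `log |L_ι| + log p(ι) ≤ s + log τ(|x|+t) < K^{τ(|x|+t)}(x) ≤ K^{p(ι)}(x)` (antitonicity of `K^t`).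

## References

* S. Hirahara, ECCC TR21-058: Lemma 5.1 and its proof (p. 29), Def. 2.5 (p. 13), Def. 4.1, Thm. 4.2,
  Remark 4.3 (p. 26), Fact 3.7 (p. 22); the sources of Lemma 5.1 cited there: S. Hirahara, *Unexpected
  hardness results for Kolmogorov complexity under uniform reductions*, STOC 2020, and *Characterizing
  average-case complexity of PH by worst-case meta-complexity*, FOCS 2020.
-/

namespace Literature.Computability.MetaComplexity

open _root_.Computability Complexity Complexity.Classes Complexity.Nondeterministic Brick Plumb Polynomial
  Cryptography

/-! ### The ensemble `{x ∈ {0,1}ⁿ | K^t(x) ≤ s}` -/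

/-- `Set.univ ∈ P` (the constant-`1` decider). [Arora–Barak 2009, §1.3] [folklore] -/
theorem univ_mem_P : (Set.univ : Language Bool) ∈ P :=
  mem_P_of_mem_FP (const_mem_FP [true]) _ fun w => ⟨fun _ => rfl, fun h => (h (Set.mem_univ w)).elim⟩

namespace UniversalMachine

variable (U : UniversalMachine)

/-- With the trivial verifier and `k = 0` the slice `L'_{⟨n,0,t,s⟩}` is `{x ∈ {0,1}ⁿ | K^t(x) ≤ s}`
(the certificate and the seed are empty, `DP₀(ỹ; ε) = ε`). [Hirahara 2021 (ECCC TR21-058),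
Lemma 5.1 (proof), proof of Thm. 8.9] [folklore] -/
theorem upSlice_univ_zero (n t s : ℕ) :
    U.upSlice Set.univ 0 n 0 t s = {x | x.length = n ∧ U.ktAt t x ≤ s} := by
  ext v
  simp only [upSlice, certSet, Set.mem_setOf_eq, eval_zero, Nat.le_zero, List.length_eq_zero_iff, mul_zero]
  constructor
  · rintro ⟨x, y, z, rfl, hx, hK, ⟨rfl, -⟩, rfl⟩
    simp only [dpGen, List.range_zero, List.map_nil, List.append_nil]
    exact ⟨hx, hK⟩
  · rintro ⟨hx, hK⟩
    refine ⟨v, [], [], ?_, hx, hK, ⟨rfl, Set.mem_univ _⟩, rfl⟩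
    simp [dpGen]

/-- **The ensemble of the proof of Lemma 5.1 and its slices.** The printed ensemble is
`L_{⟨t,s⟩} = {x | K^t(x) ≤ s}`; here it is additionally sliced by `n = |x|` and realised as the language
`L'` of the proof of Thm. 8.9 for the trivial verifier, `U.upLang Set.univ 0` (in `NP` by `upLang_mem_NP`,
an ensemble of languages by `isLanguageEnsemble_upLang`): its slice at `⟨n,0,t,s⟩` is
`{x ∈ {0,1}ⁿ | K^t(x) ≤ s}`. [Hirahara 2021 (ECCC TR21-058), Lemma 5.1 (proof), Def. 4.1]
[cite: Hirahara2021, Lemma 5.1 (proof)] -/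
theorem languageSlice_upLang_univ_zero (n t s : ℕ) :
    languageSlice (U.upLang Set.univ 0) (idx4 n 0 t s) = {x | x.length = n ∧ U.ktAt t x ≤ s} := by
  rw [languageSlice_upLang_idx4, upSlice_univ_zero]

/-- **Fact 3.7 for the slices**: `|L_{⟨n,0,t,s⟩}| < 2^{s+1}`, hence `log |L_{⟨n,0,t,s⟩}| ≤ s`
(`log = Nat.log 2`). [Hirahara 2021 (ECCC TR21-058), Fact 3.7, Lemma 5.1 (proof: "`|L_{⟨t,s⟩}| ≤ 2^{s+1}`
by Fact 3.7")] [cite: Hirahara2021, Fact 3.7] -/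
theorem log_ncard_slice_le (n t s : ℕ) : Nat.log 2 {x | x.length = n ∧ U.ktAt t x ≤ s}.ncard ≤ s := by
  have hsub : {x | x.length = n ∧ U.ktAt t x ≤ s} ⊆ {x | U.ktAt t x < ((s + 1 : ℕ) : ℕ∞)} := by
    rintro x ⟨-, hx⟩
    exact lt_of_le_of_lt hx (by exact_mod_cast Nat.lt_succ_self s)
  have hcard : {x | x.length = n ∧ U.ktAt t x ≤ s}.ncard < 2 ^ (s + 1) :=
    (Set.ncard_le_ncard hsub (U.finite_setOf_ktAt_lt' t (s + 1))).trans_lt (U.ncard_setOf_ktAt_lt t (s + 1))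
  by_cases hc : {x | x.length = n ∧ U.ktAt t x ≤ s}.ncard = 0
  · simp [hc]
  · exact Nat.lt_succ_iff.1 (Nat.log_lt_of_lt_pow hc hcard)

end UniversalMachine

/-! ### The re-encoding `⟨x, 1ᵗ, 1ˢ⟩ ↦ (x, 1^{⟨|x|,0,t,s⟩})` -/

/-- **The reduction** ("via the identity map"): a polynomial-time function mapping every triple
`⟨x, 1ᵗ, 1ˢ⟩` to `(x, 1^{⟨|x|, 0, t, s⟩})` — the brick
`fanoutFn fstF (idx4UF ∘ ⟨1^{|x|}, ⟨1⁰, ⟨1ᵗ, 1ˢ⟩⟩⟩)`. [Hirahara 2021 (ECCC TR21-058), Lemma 5.1 (proof)]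
[folklore] -/
theorem exists_gapRed : ∃ f : List Bool → List Bool, f ∈ FP ∧ ∀ (x : List Bool) (t s : ℕ),
    f (boolPair x (boolPair (unaryEncodeNat t) (unaryEncodeNat s))) = paramEnc (x, idx4 x.length 0 t s) := by
  refine ⟨fanoutFn fstF (idx4UF ∘ fanoutFn (onesFn ∘ fstF)
    (fanoutFn (fun _ => ones 0) (fanoutFn (onesFn ∘ fstF ∘ sndF) (onesFn ∘ sndF ∘ sndF)))), ?_, fun x t s => ?_⟩
  · exact fanoutFn_mem_FP fstF_mem_FP (comp_mem_FP idx4UF_mem_FP (fanoutFn_mem_FP (comp_mem_FP onesFn_mem_FP fstF_mem_FP)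
      (fanoutFn_mem_FP (const_mem_FP _) (fanoutFn_mem_FP (comp_mem_FP onesFn_mem_FP (comp_mem_FP fstF_mem_FP sndF_mem_FP))
        (comp_mem_FP onesFn_mem_FP (comp_mem_FP sndF_mem_FP sndF_mem_FP))))))
  · simp only [fanoutFn_apply, Function.comp_apply, fstF_boolPair, sndF_boolPair, CondRed.onesFn_eq_ones,
      CondRed.unaryEncodeNat_eq_ones, paramEnc, idx4]
    rw [show (ones t).length = t by simp [ones], show (ones s).length = s by simp [ones], idx4UF_apply]

/-! ### The polynomial bound on the index -/

/-- **The index is polynomially bounded on no-instances**: for every `a₀` there is a polynomial `Q`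
(namely `Q(m) = (m + ((m + a₀ + 1)² + 1)² + 1)²`, from `Nat.pair a b ≤ (a + b + 1)²`) with
`⟨n, 0, t, s⟩ ≤ Q(n + t)` whenever `s ≤ n + a₀`. [folklore] -/
theorem exists_poly_idx4_le (a₀ : ℕ) :
    ∃ Q : Polynomial ℕ, ∀ n t s : ℕ, s ≤ n + a₀ → idx4 n 0 t s ≤ Q.eval (n + t) := by
  refine ⟨((X + 1) ^ 2 : Polynomial ℕ).comp
    (X + ((X + 1) ^ 2 : Polynomial ℕ).comp (((X + 1) ^ 2 : Polynomial ℕ).comp (X + C a₀))), fun n t s hs => ?_⟩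
  -- `Nat.pair a b ≤ (a + b + 1)²` (as `AlgebraicComplexity.pair_le_sq`, not imported here)
  have pair_le_sq_succ : ∀ a b : ℕ, Nat.pair a b ≤ (a + b + 1) ^ 2 := fun a b =>
    (Nat.pair_lt_max_add_one_sq a b).le.trans (Nat.pow_le_pow_left (by omega) 2)
  have h1 : Nat.pair t s ≤ (n + t + a₀ + 1) ^ 2 :=
    (pair_le_sq_succ t s).trans (Nat.pow_le_pow_left (by omega) 2)
  have h2 : Nat.pair 0 (Nat.pair t s) ≤ ((n + t + a₀ + 1) ^ 2 + 1) ^ 2 :=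
    (pair_le_sq_succ 0 _).trans (Nat.pow_le_pow_left (by omega) 2)
  have h3 : Nat.pair n (Nat.pair 0 (Nat.pair t s)) ≤ (n + t + ((n + t + a₀ + 1) ^ 2 + 1) ^ 2 + 1) ^ 2 :=
    (pair_le_sq_succ n _).trans (Nat.pow_le_pow_left (by omega) 2)
  simpa [idx4] using h3

namespace UniversalMachine

variable (U : UniversalMachine)

/-! ### Lemma 5.1 from a separator of the compression problem of the ensemble -/

/-- **The reduction step of the proof of Lemma 5.1** (one universal machine, `τ` a function). Let
`Sep ∈ P` separate the compression problem of `U.upLang Set.univ 0` with time/size bound `p`, let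
`K^t(x) ≤ |x| + a₀` for all `t ≥ c₀`, and let `τ ≥ c₀` dominate `p` on the indices of no-instances:
`p(⟨n,0,t,s⟩) ≤ τ(n+t)` whenever `s ≤ n + a₀`. Then the preimage of `Sep` under the re-encoding separates
`Gap_τ(K vs K)`: yes-instances `K^t(x) ≤ s` land in `L_{⟨|x|,0,t,s⟩}`; on a no-instance
`s + log τ(|x|+t) < K^{τ(|x|+t)}(x) ≤ |x| + a₀` gives `s ≤ |x| + a₀`, so `p(ι) ≤ τ(|x|+t)` for
`ι = ⟨|x|,0,t,s⟩`, and `log |L_ι| + log p(ι) ≤ s + log τ(|x|+t) < K^{τ(|x|+t)}(x) ≤ K^{p(ι)}(x)`, i.e.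
the image is a no-instance of the compression problem. [Hirahara 2021 (ECCC TR21-058), Lemma 5.1
(proof, p. 29: "reducible to this promise problem via the identity map for some polynomial `τ`")]
[cite: Hirahara2021, Lemma 5.1 (proof)] -/
theorem gapKvsK_mem_PromiseP_of_separator {Sep : Set (List Bool)} (hSepP : Sep ∈ P) {p : ℕ → ℕ}
    (hyes : (U.compressionProblem (U.upLang Set.univ 0) p).yes ≤ Sep)
    (hno : (U.compressionProblem (U.upLang Set.univ 0) p).no ≤ Sepᶜ)
    {c₀ a₀ : ℕ} (hka : ∀ (x : List Bool) (t : ℕ), c₀ ≤ t → U.ktAt t x ≤ x.length + a₀)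
    {τ : ℕ → ℕ} (hτc : ∀ m, c₀ ≤ τ m) (hτp : ∀ n t s, s ≤ n + a₀ → p (idx4 n 0 t s) ≤ τ (n + t)) :
    U.gapKvsK τ ∈ PromiseP := by
  obtain ⟨f, hfFP, hf⟩ := exists_gapRed
  refine ⟨f ⁻¹' Sep, preimage_mem_P hSepP hfFP, ?_, ?_⟩
  · -- yes-instances: `K^t(x) ≤ s` puts `x` in the slice `L_{⟨|x|,0,t,s⟩}`
    rintro w ⟨x, t, s, rfl, hK⟩
    rw [Set.mem_preimage, hf]
    exact hyes ((U.paramEnc_mem_compressionProblem_yes_iff _ _).2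
      (by rw [languageSlice_upLang_univ_zero]; exact ⟨rfl, hK⟩))
  · -- no-instances
    rintro w ⟨x, t, s, rfl, hlt⟩ hmem
    replace hmem : f (boolPair x (boolPair (unaryEncodeNat t) (unaryEncodeNat s))) ∈ Sep := hmem
    rw [hf] at hmem
    -- `s ≤ |x| + a₀`
    have hKle : U.ktAt (τ (x.length + t)) x ≤ ((x.length + a₀ : ℕ) : ℕ∞) := by
      push_cast
      exact hka x _ (hτc _)
    have hs : s ≤ x.length + a₀ := by
      have := ENat.coe_lt_coe.1 (hlt.trans_le hKle)
      omega
    have hpτ : p (idx4 x.length 0 t s) ≤ τ (x.length + t) := hτp _ _ _ hs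
    -- the image is a no-instance of the compression problem, which the separator rejects
    refine hno ((U.paramEnc_mem_compressionProblem_no_iff _ _).2 ?_) hmem
    rw [languageSlice_upLang_univ_zero]
    calc ((Nat.log 2 {x' | x'.length = x.length ∧ U.ktAt t x' ≤ s}.ncard + Nat.log 2 (p (idx4 x.length 0 t s)) : ℕ) :
          ℕ∞)
        ≤ ((s + Nat.log 2 (τ (x.length + t)) : ℕ) : ℕ∞) := by
          exact_mod_cast add_le_add (U.log_ncard_slice_le x.length t s) (Nat.log_mono_right hpτ)
      _ < U.ktAt (τ (x.length + t)) x := hlt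
      _ ≤ U.ktAt (p (idx4 x.length 0 t s)) x := U.ktAt_anti hpτ x

/-- **Lemma 5.1 from Thm. 4.2 for the ensemble `{x ∈ {0,1}ⁿ | K^t(x) ≤ s}` (one universal machine).**
If the compression problem of `U.upLang Set.univ 0` with polynomial `p` is in `pr-P`, then
`Gap_τ(K vs K) ∈ pr-P` for the polynomial `τ := p ∘ Q + X + (c₀ + 1)` (`Q` from `exists_poly_idx4_le`,
`c₀, a₀` the printing constants of `exists_ktAt_le_length_add`), by
`gapKvsK_mem_PromiseP_of_separator`. [Hirahara 2021 (ECCC TR21-058), Lemma 5.1 (proof, p. 29)]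
[cite: Hirahara2021, Lemma 5.1 (proof)] -/
theorem gapKvsK_mem_PromiseP_of_compressionProblem {pc : Polynomial ℕ}
    (h : U.compressionProblem (U.upLang Set.univ 0) (fun ι => pc.eval ι) ∈ PromiseP) :
    ∃ τ : Polynomial ℕ, U.gapKvsK (fun m => τ.eval m) ∈ PromiseP := by
  obtain ⟨c₀, a₀, hka⟩ := U.exists_ktAt_le_length_add
  obtain ⟨Q, hQ⟩ := exists_poly_idx4_le a₀
  obtain ⟨Sep, hSepP, hyes, hno⟩ := h
  refine ⟨pc.comp Q + X + C (c₀ + 1),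
    U.gapKvsK_mem_PromiseP_of_separator hSepP hyes hno hka (fun m => ?_) (fun n t s hs => ?_)⟩
  · simp only [eval_add, eval_comp, eval_X, eval_C]
    omega
  · have h1 : pc.eval (idx4 n 0 t s) ≤ pc.eval (Q.eval (n + t)) := polynomial_eval_mono pc (hQ n t s hs)
    simp only [eval_add, eval_comp, eval_X, eval_C]
    omega

end UniversalMachine

/-! ### Lemma 5.1 from Thm. 4.2 (the named facts) -/

/-- **Hirahara 2021, Lemma 5.1, proved from Thm. 4.2 (algorithmic language compression) exactly as
printed**: under `coNP × {U, T} ⊆ Avg¹_{1-n^{-c}} P`, Thm. 4.2 applied to the `NP` ensemble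
`{x ∈ {0,1}ⁿ | K^t(x) ≤ s}` (`upLang_mem_NP univ_mem_P 0`, `isLanguageEnsemble_upLang`) gives a polynomial
`p` with its compression problem in `pr-P`, and `Gap_τ(K vs K)` reduces to it
(`gapKvsK_mem_PromiseP_of_compressionProblem`). Hence the named fact
`Hirahara2021_gapKvsK_mem_PromiseP` follows from the named fact `Hirahara2021_languageCompression`.
[Hirahara 2021 (ECCC TR21-058), Lemma 5.1 (proof, p. 29), Thm. 4.2] [cite: Hirahara2021, Lemma 5.1] -/
theorem Hirahara2021_gapKvsK_mem_PromiseP_of_languageCompression (h42 : Hirahara2021_languageCompression) :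
    Hirahara2021_gapKvsK_mem_PromiseP := fun U hyp => by
  obtain ⟨pc, hpc⟩ := h42 U hyp (U.upLang Set.univ 0) (U.upLang_mem_NP univ_mem_P 0)
    (UniversalMachine.isLanguageEnsemble_upLang Set.univ 0)
  exact U.gapKvsK_mem_PromiseP_of_compressionProblem hpc

end Literature.Computability.MetaComplexity
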